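import Literature.GroupTheory.GL23SubgroupClasses
import Literature.NumberTheory.LFunctions.NotAlmostMonomialSL25Characters
import Mathlib.Analysis.SpecialFunctions.Pow.Real
import HarnessLib

/-!
# Booker's counterexample `GL₂(𝔽₃)`, I: the characters `χ₄` (principal series) and `χ₂` (faithful)

Topic `Literature/NumberTheory/LFunctions`; namespace `Literature.NumberTheory.LFunctions`, grouping
namespace `Booker2006.GL23`.  First half of the discharge of the `GL₂(𝔽₃)` clause of the named fact
`booker2006_notAlmostMonomial` (`CertifiedArtinHolomorphyCriterion.lean`; Booker, Exp. Math. 15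
(2006) §2 p. 390: "That is not the case, as the counterexamples `GL₂(𝔽₃)` and `SL₂(𝔽₅)` show" — for
`GL₂(𝔽₃)` the paper prints no vector; a GAP computation).  `GL(2,3)` has irreducible characters of
degrees `1, 1, 2, 3, 3, 2, 2, 4`; irreducibles of degree `≤ 3` never split
(`AlmostMonomialLowDegree.lean`), and the GAP-free analysis (offline: the 37 monomial characters,
`work/py/gl23b.py` of the seat) shows that the ONLY splittings of Definition 2.1 are
`χ₄ = χ₂ + (χ₄ − χ₂)` with `χ₄` the irreducible character of degree `4` (the principal series
`(1, sgn)` of the Borel subgroup) and `χ₂` one of the two FAITHFUL characters of degree `2` (values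
`±i√2` on the classes of elements of order `8`).  By class type
`τ ∈ {1, −1, ord 4, ord 3, ord 6, ord 2 (det −1), 8A, 8B}`:

| `τ`            | 1 | −1 | ord4 | ord3 | ord6 | refl | 8A    | 8B    |
|----------------|---|----|------|------|------|------|-------|-------|
| `χ₄`           | 4 | −4 | 0    | 1    | −1   | 0    | 0     | 0     |
| `χ₂`           | 2 | −2 | 0    | −1   | 1    | 0    | `i√2` | `−i√2`|
| `χ₁ = χ₄ − χ₂` | 2 | −2 | 0    | 2    | −2   | 0    | `−i√2`| `i√2` |

All values lie in `ℤ[i] ⊕ ℤ[i]·u` with `u = e^{iπ/4} = (1+i)/√2` (`u² = i`, `i√2 = (1+i)u`), which is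
how the kernel computes with them (pairs of Gaussian integers).  This file PROVES:
* `χ₄ = Ind_B^G θ` (`B` upper triangular of order 12, `θ(s r; 0 t) = sgn t`), `⟨χ₄, χ₄⟩ = 1`:
  **`χ₄` is irreducible** (`isIrrChar_chi4`);
* `Ind_{C₈}^G λ = χ₂ + χ₄` for `C₈ = ⟨c⟩`, `c = (0 1; 1 1)`, `λ(cᵏ) = uᵏ`; so `χ₂ ∈ R(G)`,
  `⟨χ₂, χ₂⟩ = 1`, `χ₂(1) = 2 > 0`: **`χ₂` is irreducible** (`isIrrChar_chi2`).
The DM-positivity of `χ₁` and `¬ IsAlmostMonomial GL(2,3)` are in `NotAlmostMonomialGL23.lean`.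

## References
* [Booker2006] A. R. Booker, *Artin's conjecture, Turing's method, and the Riemann hypothesis*,
  Experiment. Math. 15 (2006) 385–407, §2 Definition 2.1 (p. 389), p. 390.
* [JamesLiebeck2001] G. James, M. Liebeck, *Representations and Characters of Groups*, 2nd ed. 2001,
  Ch. 28 (character table of `GL(2, q)`: principal series `ψ_{i,j}`, degrees), Thm. 28.5.
* [SerreLinearRepresentations1977] J.-P. Serre, *Linear Representations of Finite Groups*, §7.2, §9.1.
-/

noncomputable section

open scoped ComplexOrder MatrixGroups
open Finset Complex

namespace Literature.NumberTheory.LFunctions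

namespace Booker2006

namespace GL23

open Literature.RepresentationTheory.FiniteGroups Literature.GroupTheory Literature.GroupTheory.GL23

/-! ### The constant `u = e^{iπ/4}` and class types -/

/-- `u = (1 + i)/√2 = e^{iπ/4}`, a primitive eighth root of unity. [cite: JamesLiebeck2001, Ch. 28] -/
def uC : ℂ := ((Real.sqrt 2 / 2 : ℝ) : ℂ) * (1 + I)

/-- `u² = i` (`u = e^{iπ/4}`, the eighth root of unity of the `GL(2, q)` tables). [cite: JamesLiebeck2001, Ch. 28] -/
theorem uC_sq : uC ^ 2 = I := by
  have h2 : ((Real.sqrt 2 / 2 : ℝ) : ℂ) ^ 2 = (1 / 2 : ℂ) := by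
    have : (Real.sqrt 2 / 2) ^ 2 = (1 / 2 : ℝ) := by
      rw [div_pow, Real.sq_sqrt (by norm_num)]; norm_num
    rw [← Complex.ofReal_pow, this]; push_cast; ring
  rw [uC, mul_pow, h2]
  have hI : (1 + I) ^ 2 = 2 * I := by rw [sq]; ring_nf; rw [I_sq]; ring
  rw [hI]; ring

/-- `u⁴ = −1`. [cite: JamesLiebeck2001, Ch. 28] -/
theorem uC_pow_four : uC ^ 4 = -1 := by
  rw [show uC ^ 4 = (uC ^ 2) ^ 2 by ring, uC_sq, I_sq]

/-- `u⁸ = 1`. [cite: JamesLiebeck2001, Ch. 28] -/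
theorem uC_pow_eight : uC ^ 8 = 1 := by
  rw [show uC ^ 8 = (uC ^ 4) ^ 2 by ring, uC_pow_four]; norm_num

/-- `u ≠ 0`. [cite: JamesLiebeck2001, Ch. 28] -/
theorem uC_ne_zero : uC ≠ 0 := fun h => by
  have := uC_pow_eight; rw [h] at this; norm_num at this

/-- `ρ = (1+i)u = i√2` (the value of the faithful degree-`2` characters on elements of order `8`)
satisfies `ρ² = −2`. [cite: JamesLiebeck2001, Ch. 28] -/
theorem rho_sq : ((1 + I) * uC) ^ 2 = -2 := by
  rw [mul_pow, uC_sq, sq]; ring_nf; rw [I_sq, show I ^ 3 = I ^ 2 * I by ring, I_sq]; ring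

/-- `ℤ[i] ⊕ ℤ[i]·u → ℂ`, `(A, B) ↦ A + B u`. [folklore] -/
def toC (A B : GaussianInt) : ℂ := GaussianInt.toComplex A + GaussianInt.toComplex B * uC

/-- `−1 ∈ GL(2,3)`. [folklore] -/
def z : GL (Fin 2) (ZMod 3) := m 2 0 0 2

/-- Trace. [folklore] -/
def tr (g : GL (Fin 2) (ZMod 3)) : ZMod 3 := g.1 0 0 + g.1 1 1

/-- Determinant. [folklore] -/
def dt (g : GL (Fin 2) (ZMod 3)) : ZMod 3 := g.1 0 0 * g.1 1 1 - g.1 0 1 * g.1 1 0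

/-- The class type: `0 : 1`, `1 : −1`, `2 :` order 4, `3 :` order 3, `4 :` order 6 (all `det = 1`),
`5 :` reflections (order 2, `det = −1`), `6 : 8A` (trace `1`), `7 : 8B` (trace `2`).
[cite: JamesLiebeck2001, Ch. 28] -/
def τ (g : GL (Fin 2) (ZMod 3)) : ℕ :=
  if g = 1 then 0 else if g = z then 1 else
  if dt g = 1 then (if tr g = 0 then 2 else if tr g = 2 then 3 else 4)
  else (if tr g = 0 then 5 else if tr g = 1 then 6 else 7)

/-! ### The class functions `χ₄`, `χ₂`, `χ₁` -/

/-- The values of `χ₄` by class type. [cite: Booker2006, §2 p. 390] -/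
def T4 (g : GL (Fin 2) (ZMod 3)) : ℤ := ([4, -4, 0, 1, -1, 0, 0, 0] : List ℤ).getD (τ g) 0

/-- The `ℤ[i]`-part of `χ₂` by class type. [cite: Booker2006, §2 p. 390] -/
def A2 (g : GL (Fin 2) (ZMod 3)) : GaussianInt := ([2, -2, 0, -1, 1, 0, 0, 0] : List GaussianInt).getD (τ g) 0

/-- The `ℤ[i]·u`-part of `χ₂` by class type (`i√2 = (1+i)u` on `8A`, `−(1+i)u` on `8B`).
[cite: Booker2006, §2 p. 390] -/
def B2 (g : GL (Fin 2) (ZMod 3)) : GaussianInt :=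
  ([0, 0, 0, 0, 0, 0, ⟨1, 1⟩, ⟨-1, -1⟩] : List GaussianInt).getD (τ g) 0

/-- `χ₄ : GL(2,3) → ℂ` (the principal series character of degree `4`). [cite: Booker2006, §2 p. 390] -/
def chi4 (g : GL (Fin 2) (ZMod 3)) : ℂ := (T4 g : ℂ)

/-- `χ₂ : GL(2,3) → ℂ` (a faithful irreducible character of degree `2`). [cite: Booker2006, §2 p. 390] -/
def chi2 (g : GL (Fin 2) (ZMod 3)) : ℂ := toC (A2 g) (B2 g)

/-- `χ₁ = χ₄ − χ₂`. [cite: Booker2006, §2 p. 390] -/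
def chi1 (g : GL (Fin 2) (ZMod 3)) : ℂ := chi4 g - chi2 g

/-- `χ₄ = χ₁ + χ₂`. [cite: Booker2006, §2 p. 390] -/
theorem chi4_eq_add : chi4 = chi1 + chi2 := by
  funext g; simp [chi1]

/-- `χ₄(1) = 4`. [cite: Booker2006, §2 p. 390] -/
theorem chi4_one : chi4 1 = ((4 : ℕ) : ℂ) := by
  have : T4 1 = 4 := by decide
  simp [chi4, this]

/-- `χ₂(1) = 2`. [cite: Booker2006, §2 p. 390] -/
theorem chi2_one : chi2 1 = ((2 : ℕ) : ℂ) := by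
  have hA : A2 1 = 2 := by decide
  have hB : B2 1 = 0 := by decide
  simp [chi2, toC, hA, hB, map_ofNat]

/-- `χ₁(1) = 2`. [cite: Booker2006, §2 p. 390] -/
theorem chi1_one : chi1 1 = 2 := by
  rw [chi1, chi4_one, chi2_one]; norm_num

/-! ### The Borel subgroup and `χ₄ = Ind_B θ` -/

/-- Membership in the Borel subgroup (upper triangular). [cite: JamesLiebeck2001, Ch. 28] -/
def inB (g : GL (Fin 2) (ZMod 3)) : Bool := decide (g.1 1 0 = 0)

/-- `B` is closed under multiplication. [folklore] -/
private theorem inB_mul : ∀ a b : GL (Fin 2) (ZMod 3), inB a = true → inB b = true → inB (a * b) = true := by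
  decide +kernel

/-- `B` is closed under inversion. [folklore] -/
private theorem inB_inv : ∀ a : GL (Fin 2) (ZMod 3), inB a = true → inB a⁻¹ = true := by decide +kernel

/-- The Borel subgroup `B = {(s r; 0 t)}` of `GL(2,3)`, of order `12`. [cite: JamesLiebeck2001, Ch. 28] -/
def B : Subgroup (GL (Fin 2) (ZMod 3)) where
  carrier := {g | inB g = true}
  mul_mem' := fun {a} {b} ha hb => inB_mul a b ha hb
  one_mem' := by decide
  inv_mem' := fun {a} ha => inB_inv a ha

/-- `|B| = 12`. [folklore] -/
private theorem natCard_B : Nat.card B = 12 := by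
  have h : Nat.card B = Nat.card {g : GL (Fin 2) (ZMod 3) // inB g = true} := rfl
  rw [h, Nat.card_eq_fintype_card, Fintype.card_subtype, univ_eq_toFinset_elems]
  decide +kernel

/-- `θ(s r; 0 t) = sgn t ∈ {±1}` (the character `λ_{1,sgn}` of `B`). [cite: JamesLiebeck2001, Ch. 28] -/
def thZ (g : GL (Fin 2) (ZMod 3)) : ℤˣ := if g.1 1 1 = 1 then 1 else -1

/-- `θ(1) = 1`. [folklore] -/
private theorem thZ_one : thZ 1 = 1 := by decide

/-- `θ` is multiplicative on `B` (kernel check). [folklore] -/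
private theorem thZ_mul : ∀ a b : GL (Fin 2) (ZMod 3), inB a = true → inB b = true →
    thZ (a * b) = thZ a * thZ b := by decide +kernel

/-- `θ : B → ℤˣ`. [cite: JamesLiebeck2001, Ch. 28] -/
def thU : B →* ℤˣ where
  toFun h := thZ h
  map_one' := thZ_one
  map_mul' := fun a b => thZ_mul a b a.2 b.2

/-- `θ : B → ℂˣ`. [cite: JamesLiebeck2001, Ch. 28] -/
def th : B →* ℂˣ := (Units.map (Int.castRingHom ℂ).toMonoidHom).comp thU

/-- Values of `θ` in `ℂ`. [folklore] -/
private theorem coe_th (h : B) : ((th h : ℂˣ) : ℂ) = (((thZ h : ℤˣ) : ℤ) : ℂ) := by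
  simp [th, thU]

/-- The defining sum of `Ind_B θ` over `elems`: `Σ_t [t⁻¹st ∈ B] θ(t⁻¹st)`. [folklore] -/
def S4 (s : GL (Fin 2) (ZMod 3)) : ℤ :=
  ∑ t ∈ elems.toFinset, if inB (t⁻¹ * s * t) = true then ((thZ (t⁻¹ * s * t) : ℤˣ) : ℤ) else 0

/-- Block test for `Ind_B θ = χ₄`. [folklore] -/
def test4 (s : GL (Fin 2) (ZMod 3)) : Bool := decide (S4 s = 12 * T4 s)

/-- Block `0` of the kernel check of `test4`. [folklore] -/
private theorem test4_b0 : ((elems.drop 0).take 24).all test4 = true := by decide +kernel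
/-- Block `1` of the kernel check of `test4`. [folklore] -/
private theorem test4_b1 : ((elems.drop 24).take 24).all test4 = true := by decide +kernel

/-- **The table of `Ind_B θ`:** `Σ_t [t⁻¹st ∈ B] θ(t⁻¹st) = 12·χ₄(s)`. [cite: Booker2006, §2 p. 390] -/
theorem S4_eq (s : GL (Fin 2) (ZMod 3)) : S4 s = 12 * T4 s :=
  of_decide_eq_true (forall_of_blocks test4 test4_b0 test4_b1 s)

/-- **`χ₄ = Ind_B^{GL(2,3)} θ`.** [cite: Booker2006, §2 p. 390] -/
theorem indClassFun_B_th_eq : indClassFun B (fun h => ((th h : ℂˣ) : ℂ)) = chi4 := by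
  funext s
  rw [indClassFun_apply, natCard_B, univ_eq_toFinset_elems]
  have hsum : ∑ t ∈ elems.toFinset, Function.extend (Subtype.val : B → GL (Fin 2) (ZMod 3))
      (fun h => ((th h : ℂˣ) : ℂ)) 0 (t⁻¹ * s * t) = ((S4 s : ℤ) : ℂ) := by
    rw [S4, Int.cast_sum]
    refine Finset.sum_congr rfl fun t _ => ?_
    by_cases h : inB (t⁻¹ * s * t) = true
    · have hmem : t⁻¹ * s * t ∈ B := h
      rw [show t⁻¹ * s * t = ((⟨t⁻¹ * s * t, hmem⟩ : B) : GL (Fin 2) (ZMod 3)) from rfl,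
        extend_subtypeVal_apply, coe_th, if_pos h]
    · have hnmem : t⁻¹ * s * t ∉ B := h
      rw [extend_subtypeVal_of_not_mem _ _ hnmem, if_neg h, Int.cast_zero]
  rw [hsum, S4_eq, chi4]; push_cast; ring

/-- `χ₄` is a character of `GL(2,3)`. [cite: Booker2006, §2 p. 390] -/
theorem isCharacter_chi4 : IsCharacter (GL (Fin 2) (ZMod 3)) chi4 := by
  rw [← indClassFun_B_th_eq]; exact (isCharacter_coe_monoidHom' th).indClassFun B

/-- `Σ_g χ₄(g)χ₄(g⁻¹) = 48` (kernel check). [folklore] -/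
private theorem sum_T4_T4 : ∑ g ∈ elems.toFinset, T4 g * T4 g⁻¹ = 48 := by decide +kernel

/-- `⟨χ₄, χ₄⟩ = 1`. [cite: Booker2006, §2 p. 390] -/
theorem classInner_chi4 : classInner chi4 chi4 = 1 := by
  rw [classInner_apply, card_eq, univ_eq_toFinset_elems]
  have h : ∑ g ∈ elems.toFinset, chi4 g * chi4 g⁻¹ =
      ((∑ g ∈ elems.toFinset, T4 g * T4 g⁻¹ : ℤ) : ℂ) := by
    rw [Int.cast_sum]
    exact Finset.sum_congr rfl fun g _ => by rw [chi4, chi4, Int.cast_mul]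
  rw [h, sum_T4_T4]; push_cast; ring

/-- **`χ₄` is an irreducible character of `GL(2,3)`** (the principal series `ψ_{1,sgn}`, degree
`q + 1 = 4`). [cite: Booker2006, §2 p. 390] -/
theorem isIrrChar_chi4 : IsIrrChar (GL (Fin 2) (ZMod 3)) chi4 :=
  isCharacter_chi4.isIrrChar_of_classInner_eq_one classInner_chi4

/-! ### `C₈ = ⟨c⟩` (the listing `L8`), `λ(cᵏ) = uᵏ`, and `Ind_{C₈} λ = χ₂ + χ₄` -/

/-- Boolean membership in `C₈` (the listing `GL23.L8 = [1, c, …, c⁷]`, `c = (0 1; 1 1)`).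
[cite: Booker2006, §2 p. 390] -/
def inC (g : GL (Fin 2) (ZMod 3)) : Bool := decide (g ∈ L8)

/-- `C₈` is closed under multiplication. [folklore] -/
private theorem inC_mul : ∀ a b : GL (Fin 2) (ZMod 3), inC a = true → inC b = true → inC (a * b) = true := by
  decide +kernel

/-- `C₈` is closed under inversion. [folklore] -/
private theorem inC_inv : ∀ a : GL (Fin 2) (ZMod 3), inC a = true → inC a⁻¹ = true := by decide +kernel

/-- The cyclic subgroup `C₈ = ⟨(0 1; 1 1)⟩` of order `8`. [cite: Booker2006, §2 p. 390] -/
def C8 : Subgroup (GL (Fin 2) (ZMod 3)) where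
  carrier := {g | inC g = true}
  mul_mem' := fun {a} {b} ha hb => inC_mul a b ha hb
  one_mem' := by decide
  inv_mem' := fun {a} ha => inC_inv a ha

/-- `|C₈| = 8`. [folklore] -/
private theorem natCard_C8 : Nat.card C8 = 8 := by
  have h : Nat.card C8 = Nat.card {g : GL (Fin 2) (ZMod 3) // inC g = true} := rfl
  rw [h, Nat.card_eq_fintype_card, Fintype.card_subtype, univ_eq_toFinset_elems]
  decide +kernel

/-- The discrete logarithm on `C₈ = [c⁰, …, c⁷]` (`8` off `C₈`). [folklore] -/
def dlog (g : GL (Fin 2) (ZMod 3)) : ℕ :=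
  if g = m 1 0 0 1 then 0 else if g = m 0 1 1 1 then 1 else if g = m 1 1 1 2 then 2 else
  if g = m 1 2 2 0 then 3 else if g = m 2 0 0 2 then 4 else if g = m 0 2 2 2 then 5 else
  if g = m 2 2 2 1 then 6 else if g = m 2 1 1 0 then 7 else 8

/-- `dlog` is additive modulo `8` on `C₈` (kernel check). [folklore] -/
private theorem dlog_mul : ∀ a b : GL (Fin 2) (ZMod 3), inC a = true → inC b = true →
    dlog (a * b) = (dlog a + dlog b) % 8 := by decide +kernel

/-- `dlog 1 = 0`. [folklore] -/
private theorem dlog_one : dlog 1 = 0 := by decide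

/-- `u` as a unit of `ℂ`. [folklore] -/
def uU : ℂˣ := Units.mk0 uC uC_ne_zero

/-- `u ^ (n % 8) = u ^ n`. [folklore] -/
private theorem uU_pow_mod (n : ℕ) : uU ^ (n % 8) = uU ^ n := by
  have h8 : uU ^ 8 = 1 := by ext; simp [uU, uC_pow_eight]
  conv_rhs => rw [← Nat.mod_add_div n 8, pow_add, pow_mul, h8, one_pow, mul_one]

/-- `λ : C₈ → ℂˣ`, `λ(cᵏ) = uᵏ` (a faithful character of `C₈`). [cite: Booker2006, §2 p. 390] -/
def lam : C8 →* ℂˣ where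
  toFun h := uU ^ dlog h
  map_one' := by simp [dlog_one]
  map_mul' := fun a b => by
    rw [show ((a * b : C8) : GL (Fin 2) (ZMod 3)) = a * b from rfl, dlog_mul a b a.2 b.2, uU_pow_mod,
      pow_add]

/-- The `ℤ[i]`-coordinate of `λ̃` (extension by zero): `uᵏ = i^{k/2}` for even `k`. [folklore] -/
def A8 (g : GL (Fin 2) (ZMod 3)) : GaussianInt :=
  ([1, 0, ⟨0, 1⟩, 0, -1, 0, ⟨0, -1⟩, 0] : List GaussianInt).getD (dlog g) 0

/-- The `ℤ[i]·u`-coordinate of `λ̃`: `uᵏ = i^{(k−1)/2} u` for odd `k`. [folklore] -/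
def B8 (g : GL (Fin 2) (ZMod 3)) : GaussianInt :=
  ([0, 1, 0, ⟨0, 1⟩, 0, -1, 0, ⟨0, -1⟩] : List GaussianInt).getD (dlog g) 0

/-- `uᵏ = A + B u` for the table values, `k < 8`. [folklore] -/
private theorem uC_pow_eq (k : ℕ) (hk : k < 8) :
    uC ^ k = GaussianInt.toComplex (([1, 0, ⟨0, 1⟩, 0, -1, 0, ⟨0, -1⟩, 0] : List GaussianInt).getD k 0) +
      GaussianInt.toComplex (([0, 1, 0, ⟨0, 1⟩, 0, -1, 0, ⟨0, -1⟩] : List GaussianInt).getD k 0) * uC := by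
  have h2 := uC_sq
  have h3 : uC ^ 3 = I * uC := by rw [pow_succ, h2]
  have h4 := uC_pow_four
  have h5 : uC ^ 5 = -uC := by rw [pow_succ, h4]; ring
  have h6 : uC ^ 6 = -I := by rw [show uC ^ 6 = uC ^ 4 * uC ^ 2 by ring, h4, h2]; ring
  have h7 : uC ^ 7 = -I * uC := by rw [show uC ^ 7 = uC ^ 4 * uC ^ 2 * uC by ring, h4, h2]; ring
  interval_cases k <;> simp [h2, h3, h4, h5, h6, h7, GaussianInt.toComplex_def']

/-- On `C₈`, `λ̃ = A + B u`; off `C₈` both coordinates vanish (kernel facts about `dlog`). [folklore] -/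
private theorem dlog_lt_of_inC : ∀ g : GL (Fin 2) (ZMod 3), inC g = true → dlog g < 8 := by decide +kernel

/-- Off `C₈`, `dlog = 8`. [folklore] -/
private theorem dlog_of_not_inC : ∀ g : GL (Fin 2) (ZMod 3), inC g = false → dlog g = 8 := by decide +kernel

/-- The two `ℤ[i]`-valued defining sums of `Ind_{C₈} λ` over `elems`. [folklore] -/
def SA (s : GL (Fin 2) (ZMod 3)) : GaussianInt := ∑ t ∈ elems.toFinset, A8 (t⁻¹ * s * t)

/-- (second coordinate). [folklore] -/
def SB (s : GL (Fin 2) (ZMod 3)) : GaussianInt := ∑ t ∈ elems.toFinset, B8 (t⁻¹ * s * t)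

/-- Block test for `Ind_{C₈} λ = χ₂ + χ₄` in coordinates. [folklore] -/
def test2 (s : GL (Fin 2) (ZMod 3)) : Bool :=
  decide (SA s = 8 * (A2 s + (T4 s : GaussianInt)) ∧ SB s = 8 * B2 s)

/-- Block `0` of the kernel check of `test2`. [folklore] -/
private theorem test2_b0 : ((elems.drop 0).take 24).all test2 = true := by decide +kernel
/-- Block `1` of the kernel check of `test2`. [folklore] -/
private theorem test2_b1 : ((elems.drop 24).take 24).all test2 = true := by decide +kernel

/-- **The table of `Ind_{C₈} λ`** in coordinates: `Σ_t λ̃(t⁻¹st) = 8(χ₂ + χ₄)(s)`.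
[cite: Booker2006, §2 p. 390] -/
theorem SA_SB_eq (s : GL (Fin 2) (ZMod 3)) :
    SA s = 8 * (A2 s + (T4 s : GaussianInt)) ∧ SB s = 8 * B2 s :=
  of_decide_eq_true (forall_of_blocks test2 test2_b0 test2_b1 s)

/-- `ℤ[i] → ℂ` on an integer. [folklore] -/
private theorem toComplex_intCast (n : ℤ) : GaussianInt.toComplex (n : GaussianInt) = (n : ℂ) := by
  simp

/-- **`Ind_{C₈}^{GL(2,3)} λ = χ₂ + χ₄`.** [cite: Booker2006, §2 p. 390] -/
theorem indClassFun_C8_lam_eq : indClassFun C8 (fun h => ((lam h : ℂˣ) : ℂ)) = chi2 + chi4 := by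
  funext s
  rw [indClassFun_apply, natCard_C8, univ_eq_toFinset_elems]
  have hpt : ∀ t : GL (Fin 2) (ZMod 3),
      Function.extend (Subtype.val : C8 → GL (Fin 2) (ZMod 3)) (fun h => ((lam h : ℂˣ) : ℂ)) 0
        (t⁻¹ * s * t) =
      GaussianInt.toComplex (A8 (t⁻¹ * s * t)) + GaussianInt.toComplex (B8 (t⁻¹ * s * t)) * uC := by
    intro t
    by_cases h : inC (t⁻¹ * s * t) = true
    · have hmem : t⁻¹ * s * t ∈ C8 := h
      rw [show t⁻¹ * s * t = ((⟨t⁻¹ * s * t, hmem⟩ : C8) : GL (Fin 2) (ZMod 3)) from rfl,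
        extend_subtypeVal_apply]
      show ((uU ^ dlog (t⁻¹ * s * t) : ℂˣ) : ℂ) = _
      rw [Units.val_pow_eq_pow_val, show (uU : ℂ) = uC from rfl, A8, B8]
      exact uC_pow_eq _ (dlog_lt_of_inC _ h)
    · have hnmem : t⁻¹ * s * t ∉ C8 := h
      have h8 : dlog (t⁻¹ * s * t) = 8 := dlog_of_not_inC _ (by simpa using h)
      rw [extend_subtypeVal_of_not_mem _ _ hnmem, A8, B8, h8]
      simp
  rw [Finset.sum_congr rfl fun t _ => hpt t, Finset.sum_add_distrib, ← Finset.sum_mul,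
    ← map_sum, ← map_sum]
  change (8 : ℂ)⁻¹ * (GaussianInt.toComplex (SA s) + GaussianInt.toComplex (SB s) * uC) = _
  obtain ⟨hA, hB⟩ := SA_SB_eq s
  rw [hA, hB, Pi.add_apply, chi2, chi4, toC]
  simp only [map_mul, map_add, toComplex_intCast, map_ofNat]
  ring

/-- `χ₂` is a virtual character (`= Ind_{C₈} λ − Ind_B θ`). [cite: Booker2006, §2 p. 390] -/
theorem chi2_mem_virtChars : chi2 ∈ virtChars (GL (Fin 2) (ZMod 3)) := by
  have h : chi2 = indClassFun C8 (fun h => ((lam h : ℂˣ) : ℂ)) - chi4 := by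
    rw [indClassFun_C8_lam_eq]; abel
  rw [h]
  exact (virtChars _).sub_mem
    (((isCharacter_coe_monoidHom' lam).indClassFun C8).mem_virtChars) isCharacter_chi4.mem_virtChars

/-- `Σ_g χ₂(g) χ₂(g⁻¹)` in coordinates: the `ℤ[i]`-part is `48` (kernel check). [folklore] -/
private theorem sum_chi2_P :
    ∑ g ∈ elems.toFinset, (A2 g * A2 g⁻¹ + B2 g * B2 g⁻¹ * ⟨0, 1⟩) = 48 := by decide +kernel

/-- (the `u`-part vanishes). [folklore] -/
private theorem sum_chi2_Q : ∑ g ∈ elems.toFinset, (A2 g * B2 g⁻¹ + A2 g⁻¹ * B2 g) = 0 := by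
  decide +kernel

/-- `⟨χ₂, χ₂⟩ = 1` (products in `ℤ[i] ⊕ ℤ[i]u` with `u² = i`). [cite: Booker2006, §2 p. 390] -/
theorem classInner_chi2 : classInner chi2 chi2 = 1 := by
  rw [classInner_apply, card_eq, univ_eq_toFinset_elems]
  have hpt : ∀ g : GL (Fin 2) (ZMod 3), chi2 g * chi2 g⁻¹ =
      GaussianInt.toComplex (A2 g * A2 g⁻¹ + B2 g * B2 g⁻¹ * ⟨0, 1⟩) +
        GaussianInt.toComplex (A2 g * B2 g⁻¹ + A2 g⁻¹ * B2 g) * uC := by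
    intro g
    simp only [chi2, toC, map_add, map_mul, GaussianInt.toComplex_def' 0 1]
    have h2 := uC_sq
    push_cast
    linear_combination (GaussianInt.toComplex (B2 g) * GaussianInt.toComplex (B2 g⁻¹)) * h2
  rw [Finset.sum_congr rfl fun g _ => hpt g, Finset.sum_add_distrib, ← Finset.sum_mul, ← map_sum,
    ← map_sum, sum_chi2_P, sum_chi2_Q]
  simp [map_ofNat]

/-- **`χ₂` is an irreducible character of `GL(2,3)`** (faithful, degree `2`: a virtual character
of norm `1` and degree `2 > 0`). [cite: Booker2006, §2 p. 390] -/
theorem isIrrChar_chi2 : IsIrrChar (GL (Fin 2) (ZMod 3)) chi2 :=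
  isIrrChar_of_mem_virtChars_of_classInner_eq_one chi2_mem_virtChars classInner_chi2 chi2_one
    (by norm_num)

/-- `χ₁` is a virtual character. [cite: Booker2006, §2 p. 390] -/
theorem chi1_mem_virtChars : chi1 ∈ virtChars (GL (Fin 2) (ZMod 3)) :=
  (virtChars _).sub_mem isCharacter_chi4.mem_virtChars isIrrChar_chi2.mem_virtChars

end GL23

end Booker2006

end Literature.NumberTheory.LFunctions

end
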